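import Summits.BirchSwinnertonDyer.BirchSwinnertonDyer.Theorems.KatoDescentTamePotSupersingularJetchevIrreducibleReadingDivisibilityCoreVertexBridge
import Summits.BirchSwinnertonDyer.BirchSwinnertonDyer.Theorems.KatoDescentTamePotSupersingularJetchevIrreducibleReadingThm52KernelInputsIrred
import HarnessLib

/-!
# Route `KatoDescentPotSupersingular` (rung K9, sub-rung B5 O6 wild 3, cell `bsd-potss`): the `q = p` crux
# `WildJetchevBoundAtP` (item 19941) — its ONE specific statement S2p (at-`p` divisibility, conductor level, the
# hypothesis `hDp` of `…WildJetchevBoundAtPOfStubs`, p518161) REDUCED IN THE KERNEL to the SAME displayed readings as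
# the shared crux 20165 (skeleton v3: `stub_prop52Irred`, `stub_coreVertexExistenceIrred`, `stub_cor32Irred`,
# `stub_prop44Irred`) + [J] Thm. 5.2 for the row objects WITH THE TAMAGAWA CARRIER AT `p` ITSELF
# (seat `bsd-potss-k9-c4` g8; route-free; `--supports 19941`, helper; nothing booked, no item closed, BSD is not proved
# by any of this)

WHY. The route files 19941 as «BEYOND the signed reading … needs a NEW ARGUMENT at `v ∣ 3`» (D-AUDIT sheet
`pub/bsd-potss/plan/D-AUDIT-Hsharp-Jetchev08-plan-g19.md` §2 rows 3/6, §6: at `v ∣ p` with `p ∣ c_p` the printed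
Kummer step (Gross 6.2 (1): `p ∤ c_p ⇒ H¹(𝔽_v, Φ_v)[p] = 0`) and Jetchev's Lemma 4.3 (`E⁰(K_v^ur)` `p`-divisible,
`v ∤ p`) are void). READING Jetchev's proof (arXiv math/0703431 §§4–6) against the tree shows the carrier `q = p` is
NOT outside the method: (i) Prop. 4.9 (stringent condition of `κ_{c,m}` at the carrier) needs at `v ∣ p` only
[GZ86 III (3.1)] in the receptacle form + `E(ℚ)[p] = 0` + Lang/Milne ADT I.3.8 — in the tree as x11b3's
`X11b.Three.JetchevKummer.localKummerMap_mem_connectedKummerCondition_of_cocycle_of_hasAdditiveReduction` and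
`KolyvaginLeafAGZ31.oneCocycleClass_eq_zero_of_hasAdditiveReductionAt` (all reduction types); (ii) the local quotient
of Thm. 6.3 is the RELATIVE index `E(K_v)/(E⁰(K_v) + p^m E(K_v)) ≅ Φ_v(𝔽_p)/p^m` (`≅ ℤ/3` for Kodaira IV/IV*), not the
(un-Φ-sized) absolute Kummer group; (iii) §§5–6 (Poitou–Tate, lozenges, Čebotarev, core vertices) are carrier-blind.
This is exactly bsd-jet's road **K4** `JET.JetchevDivisibilityCarrierAdd` (tower case; END FORM
`JET.jetchevDivisibilityCarrierAdd_of_localFacts`, `Rank1ResidualJetCarrierAddEndForm.lean`, from the same closed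
inputs as the multiplicative carrier), and k8t-c4 g8's IRREDUCIBLE H63 assembly
`JetchevIrreducibleReadingThm52.tamagawaExponent_le_mInfty_of_kernelInputs_of_irreducible` (p508713) is ABSTRACT in
the carrier (`Qcar`, `𝒮`, `t`). So S2p is the irreducible reading of K4, and this file records it in the kernel:

* §1 `divisibilityAtP_of_prop52Irred_of_coreVertexExistenceIrred_of_thm63AtP` — S2p (the `hDp` schema of p518161
  VERBATIM) from `h52I` = `stub_prop52Irred`, `hCVI` = `stub_coreVertexExistenceIrred` (20165 v3, verbatim), `hRCF`
  (ring class fields are number fields; dischargeable by `JET.numberField_ringClassField`) and `H63Ip` = [J] Thm. 5.2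
  (arXiv 6.3) for the row objects with carrier `p`: conclusion `ord_p c_p(E) ≤ m_∞` — the `q := p` twin of k8t-c4's
  `divisibilityIrredAddv_of_prop52Irred_of_coreVertexExistenceIrred_of_thm63` (p504855) through the same image-free
  bridge `derivedPoint_divisible_of_prop52Row_of_section6_min`; NO `p ∤ c_p` and NO global Tamagawa binder (both
  belong to the `q ≠ p` reading; on the K9 «B» rows `3 ∣ c₃`).
* §2 `thm63AtP_of_cor32Irred_of_prop44Irred_of_kernelGapsAtP` — `H63Ip` from `h32I` = `stub_cor32Irred`, `h44I` =
  `stub_prop44Irred` (verbatim) and ONE displayed statement `hKGp` = 20165 v3's `stub_thm52KernelGapsAddv` with the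
  carrier moved to `p` (no `q`, no `p ∤ c_p`, no global Tamagawa binder; the duality count reads
  `#Q′ = p^{ord_p c_p}`): a one-line instance of p508713 at `t := ord_p c_p(E)`.

So, in the kernel: **19941 ⟸ S1 ∧ prop52Irred ∧ coreVertexExistenceIrred ∧ cor32Irred ∧ prop44Irred ∧ KernelGapsAtP
∧ PublishedInputsHeegner (∧ the idle `d_K = −4` supplement)** — five of the seven are 20165's registered stubs
verbatim; the only 19941-specific statement is `KernelGapsAtP`, whose two carrier-dependent clauses (stringent
membership `h49str` at `v ∣ p`; the count `hdual_q` with local length `#Φ_v(𝔽_p)[p^∞]`) are the ones bsd-jet's K4 end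
form discharges in the tower case from `hPT`/`hloc`/`h𝒯σ`/`h𝒯sd`/`hΦ`/`htr`/`h49str`. CONDITIONAL on every displayed
input; nothing asserted about any curve; 19941, 20165, their stubs and BSD stay open.

References: [cite: Jetchev2008, Conj. 1.3, Thm. 1.4, Lemma 4.3, Def. 4.8, Prop. 4.9, Thm. 5.1, Lemma 5.2, Thm. 6.3 (= printed Thm. 5.2, p. 821), Prop. 6.4, Rem. 6.2]
[cite: McCallumLMS1991, §3 Cor. 3.2, §4 Prop. 4.4, §5 Prop. 5.2] [cite: GrossLMS1991, §3, Prop. 5.3, Prop. 6.2 (1)]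
[cite: GrossZagier1986, III (3.1)] [cite: MilneADT2006, Ch. I Prop. 3.8].
-/

set_option autoImplicit false
-- the Theorems directory repeats the summit name (sibling precedent `KatoDescentPotSupersingularAssembly.lean`)
set_option linter.dupNamespace false

noncomputable section

open scoped Classical NumberField

open WeierstrassCurve IsDedekindDomain NumberField Literature.NumberTheory.EllipticCurves
  Literature.NumberTheory.EllipticCurves.ModularForms Literature.NumberTheory.EllipticCurves.Jetchev2008
  Literature.NumberTheory.EllipticCurves.Rank1Residual
  Literature.NumberTheory.GaloisRepresentations
  Literature.NumberTheory.GaloisRepresentations.DiscreteGaloisModule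
  Summit.BirchSwinnertonDyer.Rank1Residual Summit.BirchSwinnertonDyer.Rank1Residual.X11b
  Summit.BirchSwinnertonDyer.Rank1Residual.JET
  Summit.BirchSwinnertonDyer.BirchSwinnertonDyer.Theorems.JetchevIrreducibleReadingDivisibility

namespace Summit.BirchSwinnertonDyer.BirchSwinnertonDyer.Theorems.WildJetchevBoundAtPCoreVertexBridge

/-! ### §1 S2p from McCallum 5.2 + Jetchev 5.3 (irreducible readings, shared with 20165) + Thm. 6.3 with carrier `p` -/

/-- **S2p (at-`p` divisibility at conductor level, the `hDp` schema of `…WildJetchevBoundAtPOfStubs`) from `h52I`,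
`hCVI`, `hRCF` and `H63Ip`.** `h52I` / `hCVI` are 20165 v3's registered stubs `stub_prop52Irred` /
`stub_coreVertexExistenceIrred` VERBATIM; `H63Ip` is [J] Thm. 6.3 for the row objects with the Tamagawa carrier the
additive prime `p` (conclusion `ord_p c_p ≤ m_∞` at a core vertex of level `k > max(ord_p c_p, m_∞)`), carrying S2p's
row binders. Proof = k8t-c4's p504855 §4 with `q := p`: the complex conjugation from `IsImaginaryQuadratic K`, `p ∣ N`
from `Addv`, the image-free bridge `derivedPoint_divisible_of_prop52Row_of_section6_min` fed by
`prop52Row_of_prop52Irred` and `exists_coreVertex_of_coreVertexExistenceIrred`. CONDITIONAL; nothing asserted.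
[cite: Jetchev2008, Thm. 1.4 (proof, p. 824), Prop. 5.3, Thm. 5.2] [cite: McCallumLMS1991, §5 Prop. 5.2 (p. 304)] -/
theorem divisibilityAtP_of_prop52Irred_of_coreVertexExistenceIrred_of_thm63AtP
    (h52I : ∀ (W : WeierstrassCurve ℚ) [W.IsElliptic] [W.IsGloballyMinimal] [NeZero (W.conductorNorm ℤ)],
        ¬ W.HasCM →
        ∀ (K : Type) [Field K] [NumberField K], IsImaginaryQuadratic K →
        NumberField.discr K ≠ -3 → NumberField.discr K ≠ -4 →
        SatisfiesHeegnerHypothesis (W.conductorNorm ℤ) K →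
        ∀ (p : ℕ) [Fact p.Prime], p ≠ 2 → W.HasIrreducibleModPGaloisRep p →
        ∀ (Dt : ModularParametrizationData W (W.conductorNorm ℤ)) (β : ℤ) (ι : K →+* ℂ)
          (d₁ : KolyvaginHeegnerData Dt β ι 1), ¬ IsOfFinAddOrder d₁.derivedPoint →
        ∀ (r : ℕ), 0 < r →
        ∀ (Mr : ℕ),
          IsLeast {u : ℕ | ∃ (n : ℕ) (d : KolyvaginHeegnerData Dt β ι n), Squarefree n ∧
              n.primeFactors.card = r ∧
              (∀ ℓ ∈ n.primeFactors, Zhang2014.IsKolyvaginPrime (W.conductorNorm ℤ) W K p ℓ ∧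
                u + 1 ≤ Zhang2014.kolyvaginIndex W p ℓ) ∧
              (∃ Q : (W.baseChange (ringClassField K ι n)).toAffine.Point,
                ((p ^ u : ℕ) : ℤ) • Q = d.derivedPoint) ∧
              ¬ ∃ Q : (W.baseChange (ringClassField K ι n)).toAffine.Point,
                ((p ^ (u + 1) : ℕ) : ℤ) • Q = d.derivedPoint} Mr →
        ∀ (M : ℕ), Mr < M →
          ∃ (n : ℕ) (d : KolyvaginHeegnerData Dt β ι n), Squarefree n ∧ n.primeFactors.card = r ∧
            (∀ ℓ ∈ n.primeFactors, Zhang2014.IsKolyvaginPrime (W.conductorNorm ℤ) W K p ℓ ∧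
              M ≤ Zhang2014.kolyvaginIndex W p ℓ) ∧
            addOrderOf (d.kolyvaginClass (Fact.out : p.Prime) M) = p ^ (M - Mr) ∧
            (∃ Q : (W.baseChange (ringClassField K ι n)).toAffine.Point,
              ((p ^ Mr : ℕ) : ℤ) • Q = d.derivedPoint) ∧
            ¬ ∃ Q : (W.baseChange (ringClassField K ι n)).toAffine.Point,
              ((p ^ (Mr + 1) : ℕ) : ℤ) • Q = d.derivedPoint)
    (hCVI : ∀ (W : WeierstrassCurve ℚ) [W.IsElliptic] [W.IsGloballyMinimal] [NeZero (W.conductorNorm ℤ)],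
        ¬ W.HasCM →
        ∀ (K : Type) [Field K] [NumberField K], IsImaginaryQuadratic K →
        NumberField.discr K ≠ -3 → NumberField.discr K ≠ -4 →
        SatisfiesHeegnerHypothesis (W.conductorNorm ℤ) K →
        ∀ (τ : K ≃ₐ[ℚ] K), τ ≠ 1 →
        ∀ (p : ℕ) [Fact p.Prime], p ≠ 2 → W.HasIrreducibleModPGaloisRep p →
        ∀ (Dt : ModularParametrizationData W (W.conductorNorm ℤ)) (β : ℤ) (ι : K →+* ℂ)
          [∀ k : ℕ, NumberField (ringClassField K ι k)]
          (d₁ : KolyvaginHeegnerData Dt β ι 1), ¬ IsOfFinAddOrder d₁.derivedPoint →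
        ∀ (m : ℕ), 1 ≤ m →
        ∀ (c : ℕ) (d : KolyvaginHeegnerData Dt β ι c), Squarefree c →
          (∀ ℓ ∈ c.primeFactors, Zhang2014.IsKolyvaginPrime (W.conductorNorm ℤ) W K p ℓ) →
        ∀ (s : ℕ), ¬ IsOfFinAddOrder d.derivedPoint →
          (∃ Q : (W.baseChange (ringClassField K ι c)).toAffine.Point,
            ((p ^ s : ℕ) : ℤ) • Q = d.derivedPoint) →
          (¬ ∃ Q : (W.baseChange (ringClassField K ι c)).toAffine.Point,
            ((p ^ (s + 1) : ℕ) : ℤ) • Q = d.derivedPoint) →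
          ((s + m : ℕ) : ℕ∞) ≤ Zhang2014.levelIndex W p c →
          ∃ (c' : ℕ) (d' : KolyvaginHeegnerData Dt β ι c'), Squarefree c' ∧
            (∀ ℓ ∈ c'.primeFactors, Zhang2014.IsKolyvaginPrime (W.conductorNorm ℤ) W K p ℓ ∧
              m + s ≤ Zhang2014.kolyvaginIndex W p ℓ) ∧
            Jetchev2008.IsGlobalCoreVertex W K ι τ p m c' ∧
            ¬ IsOfFinAddOrder d'.derivedPoint ∧
            ¬ ∃ Q : (W.baseChange (ringClassField K ι c')).toAffine.Point,
              ((p ^ (s + 1) : ℕ) : ℤ) • Q = d'.derivedPoint)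
    (hRCF : ∀ (K : Type) [Field K] [NumberField K] (ι : K →+* ℂ), IsImaginaryQuadratic K →
      ∀ k : ℕ, NumberField (ringClassField K ι k))
    (H63Ip : ∀ (W : WeierstrassCurve ℚ) [W.IsElliptic] [W.IsGloballyMinimal] [NeZero (W.conductorNorm ℤ)],
      ¬ W.HasCM → ∀ (K : Type) [Field K] [NumberField K], IsImaginaryQuadratic K →
      NumberField.discr K ≠ -3 → NumberField.discr K ≠ -4 →
      SatisfiesHeegnerHypothesis (W.conductorNorm ℤ) K →
      ∀ (τ : K ≃ₐ[ℚ] K), τ ≠ 1 →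
      ∀ (p : ℕ) [Fact p.Prime], p ≠ 2 → W.analyticRank = 0 → Addv W p → 0 ≤ padicValRat p W.j →
      W.HasIrreducibleModPGaloisRep p → ¬ (∀ n : ℕ, W.HasSurjectiveModNGaloisRep (p ^ n : ℕ)) →
      (∃ Dt : ModularParametrizationData W (W.conductorNorm ℤ),
        (∀ z ∈ Dt.L.lattice, ∃ w ∈ periodLattice Dt.f, z = (Dt.c : ℂ) * w) ∧ ¬ (p : ℤ) ∣ Dt.c) →
      ∀ (Dt : ModularParametrizationData W (W.conductorNorm ℤ)) (β : ℤ) (ι : K →+* ℂ)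
        [∀ k : ℕ, NumberField (ringClassField K ι k)]
        (d₁ : KolyvaginHeegnerData Dt β ι 1), ¬ IsOfFinAddOrder d₁.derivedPoint →
      ∀ (mdiv m : {c : ℕ // Squarefree c ∧ ∀ ℓ ∈ c.primeFactors,
          Zhang2014.IsKolyvaginPrime (W.conductorNorm ℤ) W K p ℓ} → ℕ∞),
      (∀ c (u : ℕ), (u : ℕ∞) ≤ mdiv c ↔ ∀ d : KolyvaginHeegnerData Dt β ι c.1,
        ∃ Q : (W.baseChange (ringClassField K ι c.1)).toAffine.Point,
          ((p ^ u : ℕ) : ℤ) • Q = d.derivedPoint) →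
      (∀ c, m c = if mdiv c < Zhang2014.levelIndex W p c.1 then mdiv c else ⊤) →
      ∀ mInf : ℕ, (∀ c, (mInf : ℕ∞) ≤ m c) →
        (∀ m' : ℕ, ∃ c, (m' : ℕ∞) ≤ Zhang2014.levelIndex W p c.1 ∧ m c = mInf) →
      ∀ (k : ℕ) c, 1 ≤ k → Jetchev2008.IsGlobalCoreVertex W K ι τ p k c.1 → m c = mInf →
        (k : ℕ∞) + mInf ≤ Zhang2014.levelIndex W p c.1 →
        padicValNat p ((W.baseChange ℚ_[p]).localTamagawaNumber ℤ_[p]) < k → mInf < k →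
        padicValNat p ((W.baseChange ℚ_[p]).localTamagawaNumber ℤ_[p]) ≤ mInf) :
    ∀ (W : WeierstrassCurve ℚ) [W.IsElliptic] [W.IsGloballyMinimal] [NeZero (W.conductorNorm ℤ)],
      ¬ W.HasCM →
      ∀ (K : Type) [Field K] [NumberField K], IsImaginaryQuadratic K →
      NumberField.discr K ≠ -3 → NumberField.discr K ≠ -4 →
      SatisfiesHeegnerHypothesis (W.conductorNorm ℤ) K →
      ∀ (p : ℕ) [Fact p.Prime], p ≠ 2 → W.analyticRank = 0 → Addv W p → 0 ≤ padicValRat p W.j →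
      W.HasIrreducibleModPGaloisRep p → ¬ (∀ n : ℕ, W.HasSurjectiveModNGaloisRep (p ^ n : ℕ)) →
      (∃ Dt : ModularParametrizationData W (W.conductorNorm ℤ),
        (∀ z ∈ Dt.L.lattice, ∃ w ∈ periodLattice Dt.f, z = (Dt.c : ℂ) * w) ∧ ¬ (p : ℤ) ∣ Dt.c) →
      ∀ (Dt : ModularParametrizationData W (W.conductorNorm ℤ)) (β : ℤ) (ι : K →+* ℂ)
        (d₁ : KolyvaginHeegnerData Dt β ι 1), ¬ IsOfFinAddOrder d₁.derivedPoint →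
      ∀ (s : ℕ), s ≤ padicValNat p ((W.baseChange ℚ_[p]).localTamagawaNumber ℤ_[p]) →
      ∀ (n : ℕ) (d : KolyvaginHeegnerData Dt β ι n), Squarefree n →
        (∀ ℓ ∈ n.primeFactors, Zhang2014.IsKolyvaginPrime (W.conductorNorm ℤ) W K p ℓ ∧
          s ≤ Zhang2014.kolyvaginIndex W p ℓ) →
        ∃ Q : (W.baseChange (ringClassField K ι n)).toAffine.Point,
          ((p ^ s : ℕ) : ℤ) • Q = d.derivedPoint := by
  intro W _ _ _ hcm K _ _ hK hD3 hD4 hH p _ hp2 hr hadd hj hirr hns hopt Dt β ι d₁ hy s hs n d hn hℓ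
  have hp : p.Prime := Fact.out
  have hpN : p ∣ W.conductorNorm ℤ := (W.dvd_conductorNorm_iff_not_hasGoodReductionAtPrime p).mpr hadd.1
  obtain ⟨τ, hτ⟩ := exists_algEquiv_ne_one_of_isImaginaryQuadratic K hK
  haveI : ∀ k : ℕ, NumberField (ringClassField K ι k) := hRCF K ι hK
  refine derivedPoint_divisible_of_prop52Row_of_section6_min W K p Dt β ι
    (prop52Row_of_prop52Irred h52I W hcm K hK hD3 hD4 hH p hp2 hirr Dt β ι d₁ hy) _ ?_ s hs n d hn hℓ
  intro mdiv m hchar hmdef mInf hmInf hKoly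
  exact ⟨fun k c ↦ Jetchev2008.IsGlobalCoreVertex W K ι τ p k c.1,
    fun k c hk hmc hMc ↦ exists_coreVertex_of_coreVertexExistenceIrred hCVI W hcm K hK hD3 hD4 hH τ hτ p hp2
      hirr hpN Dt β ι d₁ hy mdiv m hchar hmdef mInf k c hk hmc hMc,
    fun k c hk hcore hmc hMc htk hik ↦ H63Ip W hcm K hK hD3 hD4 hH τ hτ p hp2 hr hadd hj hirr hns hopt Dt β ι
      d₁ hy mdiv m hchar hmdef mInf hmInf hKoly k c hk hcore hmc hMc htk hik⟩

/-! ### §2 Thm. 6.3 with carrier `p` for the row objects, from Cor. 3.2 / Prop. 4.4 (irreducible readings, shared with 20165) and ONE displayed kernel-gaps statement at the carrier `p` -/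

/-- **`H63Ip` ([J] Thm. 6.3 for the row objects, Tamagawa carrier = the additive prime `p`) from `h32I` =
`stub_cor32Irred`, `h44I` = `stub_prop44Irred` (20165 v3, verbatim) and `hKGp`** = 20165 v3's
`stub_thm52KernelGapsAddv` with the carrier MOVED TO `p`: same row binders plus S2p's (`r_an = 0`, tower not onto,
lattice-optimal datum with `p ∤ c`), NO `q`, NO `p ∤ c_p`, NO global Tamagawa binder; it supplies the named print
(Gross §3 CM facts, Prop. 5.3's sign, [GZ86 III (3.1)] in the receptacle form at every bad place with an integer `n′`
prime to `p`), Selmer structures `𝒯` (transverse at the primes of `c`), `𝒮 ≤` Kummer (the stringent family —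
intended: the connected Kummer condition at the places `Qcar` over `p`), `Qcar` disjoint from `c`, the sign `e′`, the
dual part `C′`, and the five kernel gaps: `htr`, the Poitou–Tate count `hdual_q` with `#Q′ = p^{ord_p c_p(E)}` (local
length `#Φ_v(𝔽_p)[p^∞]` at `v ∣ p`), the stringent membership `h49str` at `Qcar` (Prop. 4.9 at `v ∣ p`: x11b3's
`localKummerMap_mem_connectedKummerCondition_of_cocycle_of_hasAdditiveReduction` territory), `h49tr`, `hdual_ℓ`. Proof:
k8t-c4's carrier-abstract assembly `tamagawaExponent_le_mInfty_of_kernelInputs_of_irreducible` (p508713) at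
`t := ord_p c_p(E)`. CONDITIONAL; nothing asserted.
[cite: Jetchev2008, Thm. 5.2 (p. 821) and proof, Def. 4.8, Prop. 4.9, Thm. 5.1] [cite: McCallumLMS1991, §3 Cor. 3.2, §4 Prop. 4.4]
[cite: GrossLMS1991, Prop. 5.3, Prop. 6.2 (1)] [cite: GrossZagier1986, III (3.1)] -/
theorem thm63AtP_of_cor32Irred_of_prop44Irred_of_kernelGapsAtP
    (h32I : ∀ (N : ℕ) [NeZero N] (W : WeierstrassCurve ℚ) [W.IsElliptic] [W.IsGloballyMinimal],
        ¬ W.HasCM →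
        ∀ (K : Type) [Field K] [NumberField K], IsImaginaryQuadratic K →
        ∀ (p : ℕ), p.Prime → p ≠ 2 → W.HasIrreducibleModPGaloisRep p →
        ∀ (c : K ≃ₐ[ℚ] K), c ≠ 1 →
        ∀ (M : ℕ), 1 ≤ M →
        ∀ (r : ℕ) (cs : Fin r → galH1Torsion (W.baseChange K) ((p ^ M : ℕ) : ℤ)),
          (∀ i, cs i ≠ 0) →
          (∀ i, ∃ e : ℤ, (e = 1 ∨ e = -1) ∧ conjAct W c ((p ^ M : ℕ) : ℤ) (cs i) = e • cs i) →
          (∀ a : Fin r → ℤ, ∑ i, a i • cs i = 0 → ∀ i, (addOrderOf (cs i) : ℤ) ∣ a i) →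
        ∀ (Mi : Fin r → ℕ), (∀ i, addOrderOf (cs i) = p ^ Mi i) →
        ∀ (Nv : Fin r → ℕ), (∀ i, Nv i ≤ Mi i) →
          Set.Infinite {ℓ : ℕ | FrobEqFrobInfty W K (p ^ M) ℓ ∧
            Zhang2014.IsKolyvaginPrime N W K p ℓ ∧ M ≤ Zhang2014.kolyvaginIndex W p ℓ ∧
            ∀ i, ∀ v : HeightOneSpectrum (𝓞 K), (ℓ : 𝓞 K) ∈ v.asIdeal →
              ∀ j : ℕ, ((p ^ j : ℕ) : ℤ) • cs i ∈
                  (W.baseChange K).torsionLocalKer (v.adicCompletion K) ((p ^ M : ℕ) : ℤ) ↔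
                Nv i ≤ j})
    (h44I : ∀ (W : WeierstrassCurve ℚ) [W.IsElliptic] [W.IsGloballyMinimal] [NeZero (W.conductorNorm ℤ)],
        ¬ W.HasCM →
        ∀ (K : Type) [Field K] [NumberField K], IsImaginaryQuadratic K →
        NumberField.discr K ≠ -3 → NumberField.discr K ≠ -4 →
        SatisfiesHeegnerHypothesis (W.conductorNorm ℤ) K →
        ∀ (p : ℕ) [Fact p.Prime], p ≠ 2 → W.HasIrreducibleModPGaloisRep p →
        ∀ (Dt : ModularParametrizationData W (W.conductorNorm ℤ)) (β : ℤ) (ι : K →+* ℂ)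
          (M : ℕ), 1 ≤ M →
        ∀ (m l : ℕ), Squarefree (m * l) → l.Prime → ¬ l ∣ m →
          (∀ l' ∈ (m * l).primeFactors, Zhang2014.IsKolyvaginPrime (W.conductorNorm ℤ) W K p l' ∧
            M ≤ Zhang2014.kolyvaginIndex W p l') →
        ∀ (d : KolyvaginHeegnerData Dt β ι m) (d' : KolyvaginHeegnerData Dt β ι (m * l)),
          (∀ l' ∈ m.primeFactors, ∀ (x : ringClassField K ι m) (x' : ringClassField K ι (m * l)),
            (x : ℂ) = x' → ((d'.σ l' x' : ringClassField K ι (m * l)) : ℂ) = (d.σ l' x : ℂ)) →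
          (∀ s ∈ d.S, ∃ s' ∈ d'.S, ∀ (x : ringClassField K ι m) (x' : ringClassField K ι (m * l)),
            (x : ℂ) = x' → ((s' x' : ringClassField K ι (m * l)) : ℂ) = (s x : ℂ)) →
          (∀ s' ∈ d'.S, ∃ s ∈ d.S, ∀ (x : ringClassField K ι m) (x' : ringClassField K ι (m * l)),
            (x : ℂ) = x' → ((s' x' : ringClassField K ι (m * l)) : ℂ) = (s x : ℂ)) →
          (∀ (x : ringClassField K ι m) (x' : ringClassField K ι (m * l)),
            (x : ℂ) = x' → d'.emb x' = d.emb x) →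
        ∀ (v : HeightOneSpectrum (𝓞 K)), (l : 𝓞 K) ∈ v.asIdeal →
        ∀ (j : ℕ),
          (((p ^ j : ℕ) : ℤ) • d'.kolyvaginClass (Fact.out : p.Prime) M ∈
              selmerLocalKer (W.baseChange K) (v.adicCompletion K) ((p ^ M : ℕ) : ℤ) ↔
            ((p ^ j : ℕ) : ℤ) • d'.kolyvaginClass (Fact.out : p.Prime) M ∈
              (W.baseChange K).torsionLocalKer (v.adicCompletion K) ((p ^ M : ℕ) : ℤ)) ∧
          (((p ^ j : ℕ) : ℤ) • d'.kolyvaginClass (Fact.out : p.Prime) M ∈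
              (W.baseChange K).torsionLocalKer (v.adicCompletion K) ((p ^ M : ℕ) : ℤ) ↔
            ((p ^ j : ℕ) : ℤ) • d.kolyvaginClass (Fact.out : p.Prime) M ∈
              (W.baseChange K).torsionLocalKer (v.adicCompletion K) ((p ^ M : ℕ) : ℤ)))
    (hKGp : ∀ (W : WeierstrassCurve ℚ) [W.IsElliptic] [W.IsGloballyMinimal] [NeZero (W.conductorNorm ℤ)],
      ¬ W.HasCM → ∀ (K : Type) [Field K] [NumberField K], IsImaginaryQuadratic K →
      NumberField.discr K ≠ -3 → NumberField.discr K ≠ -4 →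
      SatisfiesHeegnerHypothesis (W.conductorNorm ℤ) K →
      ∀ (τ : K ≃ₐ[ℚ] K), τ ≠ 1 →
      ∀ (p : ℕ) [Fact p.Prime], p ≠ 2 → W.analyticRank = 0 → Addv W p → 0 ≤ padicValRat p W.j →
      W.HasIrreducibleModPGaloisRep p → ¬ (∀ n : ℕ, W.HasSurjectiveModNGaloisRep (p ^ n : ℕ)) →
      (∃ Dt : ModularParametrizationData W (W.conductorNorm ℤ),
        (∀ z ∈ Dt.L.lattice, ∃ w ∈ periodLattice Dt.f, z = (Dt.c : ℂ) * w) ∧ ¬ (p : ℤ) ∣ Dt.c) →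
      ∀ (Dt : ModularParametrizationData W (W.conductorNorm ℤ)) (β : ℤ) (ι : K →+* ℂ)
        [∀ k : ℕ, NumberField (ringClassField K ι k)]
        (d₁ : KolyvaginHeegnerData Dt β ι 1), ¬ IsOfFinAddOrder d₁.derivedPoint →
      ∀ (mdiv m : {c : ℕ // Squarefree c ∧ ∀ ℓ ∈ c.primeFactors,
          Zhang2014.IsKolyvaginPrime (W.conductorNorm ℤ) W K p ℓ} → ℕ∞),
      (∀ c (u : ℕ), (u : ℕ∞) ≤ mdiv c ↔ ∀ d : KolyvaginHeegnerData Dt β ι c.1,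
        ∃ Q : (W.baseChange (ringClassField K ι c.1)).toAffine.Point,
          ((p ^ u : ℕ) : ℤ) • Q = d.derivedPoint) →
      (∀ c, m c = if mdiv c < Zhang2014.levelIndex W p c.1 then mdiv c else ⊤) →
      ∀ mInf : ℕ, (∀ c, (mInf : ℕ∞) ≤ m c) →
        (∀ m' : ℕ, ∃ c, (m' : ℕ∞) ≤ Zhang2014.levelIndex W p c.1 ∧ m c = mInf) →
      ∀ (k : ℕ) c, 1 ≤ k → Jetchev2008.IsGlobalCoreVertex W K ι τ p k c.1 → m c = mInf →
        (k : ℕ∞) + mInf ≤ Zhang2014.levelIndex W p c.1 →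
        padicValNat p ((W.baseChange ℚ_[p]).localTamagawaNumber ℤ_[p]) < k → mInf < k →
        (phi_heegnerPointOfConductor_mem_range_map_ringClassField (W.conductorNorm ℤ) W K ∧
        exists_generator_ringClassGalOver K ∧
        ∃ (ε : ℤ), (ε = 1 ∨ ε = -1) ∧
          (∀ (m : ℕ) (dm : KolyvaginHeegnerData Dt β ι m)
            (τm : ringClassField K ι m ≃ₐ[ℚ] ringClassField K ι m),
            (∀ x : ringClassField K ι m, ((τm x : ringClassField K ι m) : ℂ) = starRingEnd ℂ x) →
            ∃ σ' ∈ ringClassGal ι m, IsOfFinAddOrder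
            (pointGalHom W (ringClassField K ι m) τm dm.y -
            ε • pointGalHom W (ringClassField K ι m) σ' dm.y)) ∧
          ∃ (n' : ℤ), IsCoprime (p : ℤ) n' ∧
          (∀ (m : ℕ) (dm : KolyvaginHeegnerData Dt β ι m)
            (γ : ringClassField K ι m ≃ₐ[ℚ] ringClassField K ι m), γ ∈ ringClassGal ι m →
            ∀ v : HeightOneSpectrum (𝓞 K), ¬ (W.baseChange K).HasGoodReductionAt v →
            n' • pointsMap (W.baseChange K) (v.adicCompletion K)
            (dm.toGeomPoints (pointGalHom W (ringClassField K ι m) γ dm.y)) ∈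
            E0Receptacle (W.baseChange K) v ∧
            ∀ (ℓ : ℕ), ℓ ∈ m.primeFactors → ∀ (dm' : KolyvaginHeegnerData Dt β ι (m / ℓ))
            (hle : ringClassField K ι (m / ℓ) ≤ ringClassField K ι m),
            n' • pointsMap (W.baseChange K) (v.adicCompletion K)
            (dm.toGeomPoints (pointGalHom W (ringClassField K ι m) γ
            (WeierstrassCurve.Affine.Point.map (W' := W)
            ((RingClassField.inclusion ι hle).restrictScalars ℚ) dm'.y))) ∈
            E0Receptacle (W.baseChange K) v) ∧
          ∃ (𝒯 𝒮 : SelmerStructure ((W.baseChange K).torsionGaloisModule ((p ^ k : ℕ) : ℤ)))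
            (Qcar : Finset (HeightOneSpectrum (𝓞 K))) (e' : ℤ)
            (C' : AddSubgroup (galH1Torsion (W.baseChange K) ((p ^ k : ℕ) : ℤ))),
            (∀ x : galoisCohomology ((W.baseChange K).torsionGaloisModule ((p ^ k : ℕ) : ℤ)) 1,
              (∀ w ∈ placesDividing K c.1,
              galoisCohomology.localization ((W.baseChange K).torsionGaloisModule ((p ^ k : ℕ) : ℤ))
              (Sum.inr w) 1 x ∈ 𝒯 (Sum.inr w)) ↔
              ∀ ℓ ∈ c.1.primeFactors, x ∈ transverseKer W K ι ((p ^ k : ℕ) : ℤ) ℓ) ∧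
            (∀ v, 𝒮 v ≤ (W.baseChange K).kummerSelmerStructure ((p ^ k : ℕ) : ℤ) v) ∧
            Disjoint Qcar (placesDividing K c.1) ∧
            e' = ε * (-1) ^ c.1.primeFactors.card ∧
            C' ≤ signPart W K τ ((p ^ k : ℕ) : ℤ) (-e') ⊤ ∧
            (∀ (d : KolyvaginHeegnerData Dt β ι c.1), ∀ ℓ ∈ c.1.primeFactors,
              (d.kolyvaginClass (Fact.out : p.Prime) k :
              galoisCohomology ((W.baseChange K).torsionGaloisModule ((p ^ k : ℕ) : ℤ)) 1) ∈
              transverseKer W K ι ((p ^ k : ℕ) : ℤ) ℓ) ∧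
            (∃ (Qg Qg' : Type) (_ : AddCommGroup Qg) (_ : AddCommGroup Qg') (_ : Finite Qg')
              (locq : signPart W K τ ((p ^ k : ℕ) : ℤ) (-e')
              (modifiedSelmerGroup W K ι ((p ^ k : ℕ) : ℤ) c.1) →+ Qg)
              (locq' : C' →+ Qg'),
              (∀ x : C', locq' x = 0 ↔ (x : galH1Torsion (W.baseChange K) ((p ^ k : ℕ) : ℤ)) ∈
              signPart W K τ ((p ^ k : ℕ) : ℤ) (-e') (modifiedSelmerGroup W K ι ((p ^ k : ℕ) : ℤ) c.1)) ∧
              Nat.card locq.range * Nat.card locq'.range = Nat.card Qg' ∧ IsAddCyclic Qg' ∧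
              Nat.card Qg' = p ^ padicValNat p ((W.baseChange ℚ_[p]).localTamagawaNumber ℤ_[p])) ∧
            (∀ (ℓ : ℕ), Zhang2014.IsKolyvaginPrime (W.conductorNorm ℤ) W K p ℓ →
              k ≤ Zhang2014.kolyvaginIndex W p ℓ → ℓ ∉ c.1.primeFactors →
              ∀ (d' : KolyvaginHeegnerData Dt β ι (c.1 * ℓ)), ∀ q ∈ Qcar,
              galoisCohomology.localization ((W.baseChange K).torsionGaloisModule ((p ^ k : ℕ) : ℤ))
              (Sum.inr q) 1 (d'.kolyvaginClass (Fact.out : p.Prime) k) ∈ 𝒮 (Sum.inr q)) ∧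
            (∀ (ℓ : ℕ), Zhang2014.IsKolyvaginPrime (W.conductorNorm ℤ) W K p ℓ →
              k ≤ Zhang2014.kolyvaginIndex W p ℓ → ℓ ∉ c.1.primeFactors →
              ∀ (d' : KolyvaginHeegnerData Dt β ι (c.1 * ℓ)), ∀ w ∈ placesDividing K c.1,
              galoisCohomology.localization ((W.baseChange K).torsionGaloisModule ((p ^ k : ℕ) : ℤ))
              (Sum.inr w) 1 (d'.kolyvaginClass (Fact.out : p.Prime) k) ∈ 𝒯 (Sum.inr w)) ∧
            (∀ (ℓ : ℕ), Zhang2014.IsKolyvaginPrime (W.conductorNorm ℤ) W K p ℓ →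
              k ≤ Zhang2014.kolyvaginIndex W p ℓ → ℓ ∉ c.1.primeFactors →
              ∀ (v : HeightOneSpectrum (𝓞 K)), (ℓ : 𝓞 K) ∈ v.asIdeal →
              ∃ (Sg : Type) (_ : AddCommGroup Sg)
              (sing : signPart W K τ ((p ^ k : ℕ) : ℤ) (-e')
              (((selmerF0 W ((p ^ k : ℕ) : ℤ) 𝒯 𝒮 (placesDividing K c.1) Qcar).relaxedAt {v}).selmerGroup) →+ Sg),
              (∀ x, sing x = 0 ↔ (x : galoisCohomology ((W.baseChange K).torsionGaloisModule ((p ^ k : ℕ) : ℤ)) 1) ∈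
              signPart W K τ ((p ^ k : ℕ) : ℤ) (-e')
              ((selmerF0 W ((p ^ k : ℕ) : ℤ) 𝒯 𝒮 (placesDividing K c.1) Qcar).selmerGroup)) ∧
              Nat.card sing.range *
              Nat.card (C'.map (galoisCohomology.localization
              ((W.baseChange K).torsionGaloisModule ((p ^ k : ℕ) : ℤ)) (Sum.inr v) 1 :
              galH1Torsion (W.baseChange K) ((p ^ k : ℕ) : ℤ) →+ _)) = p ^ k)))
    (W : WeierstrassCurve ℚ) [W.IsElliptic] [W.IsGloballyMinimal] [NeZero (W.conductorNorm ℤ)]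
    (hcm : ¬ W.HasCM) (K : Type) [Field K] [NumberField K] (hK : IsImaginaryQuadratic K)
    (hD3 : NumberField.discr K ≠ -3) (hD4 : NumberField.discr K ≠ -4)
    (hH : SatisfiesHeegnerHypothesis (W.conductorNorm ℤ) K)
    (τ : K ≃ₐ[ℚ] K) (hτ : τ ≠ 1)
    (p : ℕ) [Fact p.Prime] (hp2 : p ≠ 2) (hr : W.analyticRank = 0) (hadd : Addv W p)
    (hj : 0 ≤ padicValRat p W.j) (hirr : W.HasIrreducibleModPGaloisRep p)
    (hns : ¬ (∀ n : ℕ, W.HasSurjectiveModNGaloisRep (p ^ n : ℕ)))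
    (hopt : ∃ Dt : ModularParametrizationData W (W.conductorNorm ℤ),
      (∀ z ∈ Dt.L.lattice, ∃ w ∈ periodLattice Dt.f, z = (Dt.c : ℂ) * w) ∧ ¬ (p : ℤ) ∣ Dt.c)
    (Dt : ModularParametrizationData W (W.conductorNorm ℤ)) (β : ℤ) (ι : K →+* ℂ)
    [∀ k : ℕ, NumberField (ringClassField K ι k)]
    (d₁ : KolyvaginHeegnerData Dt β ι 1) (hd₁ : ¬ IsOfFinAddOrder d₁.derivedPoint)
    (mdiv m : {c : ℕ // Squarefree c ∧ ∀ ℓ ∈ c.primeFactors,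
        Zhang2014.IsKolyvaginPrime (W.conductorNorm ℤ) W K p ℓ} → ℕ∞)
    (hmdiv : ∀ c (u : ℕ), (u : ℕ∞) ≤ mdiv c ↔ ∀ d : KolyvaginHeegnerData Dt β ι c.1,
      ∃ Q : (W.baseChange (ringClassField K ι c.1)).toAffine.Point,
        ((p ^ u : ℕ) : ℤ) • Q = d.derivedPoint)
    (hm : ∀ c, m c = if mdiv c < Zhang2014.levelIndex W p c.1 then mdiv c else ⊤)
    (mInf : ℕ) (hmin : ∀ c, (mInf : ℕ∞) ≤ m c)
    (hwit : ∀ m' : ℕ, ∃ c, (m' : ℕ∞) ≤ Zhang2014.levelIndex W p c.1 ∧ m c = mInf)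
    (k : ℕ) (c : {c : ℕ // Squarefree c ∧ ∀ ℓ ∈ c.primeFactors,
        Zhang2014.IsKolyvaginPrime (W.conductorNorm ℤ) W K p ℓ}) (hk : 1 ≤ k)
    (hcore : Jetchev2008.IsGlobalCoreVertex W K ι τ p k c.1) (hmc : m c = mInf)
    (hkM : (k : ℕ∞) + mInf ≤ Zhang2014.levelIndex W p c.1)
    (htk : padicValNat p ((W.baseChange ℚ_[p]).localTamagawaNumber ℤ_[p]) < k) (hik : mInf < k) :
    padicValNat p ((W.baseChange ℚ_[p]).localTamagawaNumber ℤ_[p]) ≤ mInf := by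
  obtain ⟨hCM1, hCM2, ε, hε, h53, n', hcop', hGZ, 𝒯, 𝒮, Qcar, e', C', hT, hS, hQcar, he', hC, htr, hdual_q,
      h49str, h49tr, hdual_ℓ⟩ :=
    hKGp W hcm K hK hD3 hD4 hH τ hτ p hp2 hr hadd hj hirr hns hopt Dt β ι d₁ hd₁ mdiv m hmdiv hm mInf hmin
      hwit k c hk hcore hmc hkM htk hik
  exact JetchevIrreducibleReadingThm52.tamagawaExponent_le_mInfty_of_kernelInputs_of_irreducible h32I h44I W hcm
    K hK hD3 hD4 hH hCM1 hCM2 p hp2 hirr ((W.dvd_conductorNorm_iff_not_hasGoodReductionAtPrime p).mpr hadd.1)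
    Dt β ι τ hτ ε hε h53 hcop' hGZ mdiv m hmdiv hm k c hk hcore mInf hmc hkM _ htk hik 𝒯 𝒮 hT hS Qcar hQcar
    e' he' C' hC htr hdual_q h49str h49tr hdual_ℓ

end Summit.BirchSwinnertonDyer.BirchSwinnertonDyer.Theorems.WildJetchevBoundAtPCoreVertexBridge

end
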